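import Summits.HodgeConjecture.HodgeConjecture.Theorems.F0P3cDbTEnvelopeTrichotomy          -- ★ `comap_cmDatumLocalCongr_symm_eq` (congruence independence, `N = 3`); brings D6 `MemXiFamily`, `IsXiLocalFamily`, `cmSplitPacket`, `splitWitness`, the (S-G) vocabulary
import Summits.HodgeConjecture.HodgeConjecture.Theorems.F0P3SqNSNonsplitConsumers             -- ★ K3♭ `eventually_not_isSupercuspidal_of_isSpherical_congr_of_nonsplit` (+ ★ compact centre at non-split `v`, ★ `forall_mem_center_cmLocal_eq_scalar`)
import Summits.HodgeConjecture.HodgeConjecture.Theorems.F0P3SqIntNotSphericalNonsplitCofinite  -- ★ (SqNS♭) `squareIntegrableNotSpherical_nonsplit_cofinite` (no `L²` class is `U(Φ₃)(𝒪_v)`-spherical, a.e. non-split `v`) — hypothesis-free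
import Summits.HodgeConjecture.HodgeConjecture.Theorems.F0P3N3ConeClosed                     -- ★ `keysCaseTwo_holds : ∀ L, KeysCaseTwo L` (exactly one `L²` constituent)
import Literature.NumberTheory.Rogawski1990.SemilocalQuadraticCharExtension                  -- ★ `isQuadraticCharExtension_semilocalComponent_of_baseChange_eq` (`μ|_{L⁺_v^×} = ω` from `hμω`)
import Literature.NumberTheory.Automorphic.LocalUnitaryIntegralLevelCongr                    -- ★ `eventually_exists_cmDatumLocalCongr_levelMatching_three` (level-matching frames, a.e.)
import Literature.NumberTheory.Rogawski1990.CharIdentityOnTestFunctionsSignedLemmas          -- (statement vocabulary of (AE-ⅰ): `hQS`'s type; = tree FILE B :3)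
import Literature.NumberTheory.Rogawski1990.FinExplicitTransferFactorConjLeft                -- (statement vocabulary: `finExplicitCollection`; = tree FILE B :4)
import Literature.NumberTheory.Rogawski1990.FinExplicitTransferFactorConjRight               -- (= tree FILE B :5)
import Literature.NumberTheory.Automorphic.OrbitalMeasureCanonical                           -- (= tree FILE B :6)
import Summits.HodgeConjecture.HodgeConjecture.Theorems.F0P3aArchDefinitePlace               -- (statement vocabulary: `ShimuraVarieties.hermForm`; = tree FILE B :7)
import HarnessLib

/-!
# R90-TF · S9 «InnerForm-13.3.6 (c)» — (AE-ⅰ) «ENVELOPE ⟹ E.V.P.» PAID DOWN TO FLATH: the first binder `hAE` of ★ `R90S9DefiniteXiMembershipCut.definiteXiMembership_of_ch14`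
# from ONE ξ-free input «off a finite set, every `v`-constituent of a discrete `P` of `U(H)` is `U(H)(𝒪_v)`-spherical» (Flath) — everything else is ★

Cell `hodgecm-mathlib`, crux H413 (`stmt-HodgeConjecture-24833`, lane `--supports … --as helper`), route of record `HCCMUnconditional` (count-neutral).  Programme R90-TF,
section S9 (base `R90-IF`); seat R90-IF-p04 (g0), deal p04 (b) «★-closable fragments on the way» (R90-IF-plan (g0) «EMIT S9 WAVE 1», R90 bus 2026-09-04T15:27:13Z),
sequel to ★ `Theorems/R90S9DefiniteXiMembershipCut.lean` (p861479, commit ec0cbb14b7ec).  THEOREMS ONLY (no `def`, no instance, no notation, no named fact, no `sorry`);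
never imports a `Cruxes/…/Lines` module; namespace `Summit.HodgeConjecture.HodgeConjecture.R90.S9`.
HONEST LABEL: HC_CM is proved only modulo the 7 printed citations (2 remaining named inputs: hLiu418 = stmt-HodgeConjecture-24832, h413 = stmt-HodgeConjecture-24833)
— until rung 0 closes.  This file proves LOCAL bookkeeping only (no trace formula): it removes `ξ`, `hQS`, Keys labels and the envelope from the first cut binder.

## THE THEOREM `aeXiTrigger_of_flath : (FLATH) → (AE-ⅰ)`
* **(FLATH) `hFlath`** (the ONLY hypothesis; ξ-free, packet-free; JUNCTION PENDING — ★ E1 `K2E1OccursEventuallySpherical.OccursEventuallySpherical` gives it for an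
  OCCURRING FAMILY of classes of `P`, i.e. for ONE constituent per place; the «every constituent» form needs local isotypy of `P|_{U(H)(L⁺_v)}` (T5 law (L7″), ★ on the
  cotangent locus `F0P3AutomorphicFlathAdmissibleOfCot.localIsotypyFin₀_of_isCot`)): for every CM `L`, hermitian `H` with unit determinant, automorphic measure `μA` and
  discrete `P` of `U(H)(𝔸)`: `∀ᶠ v in cofinite`, every `v`-constituent `c` of `P` (D6 currency) is `U(H)(𝒪_v)`-spherical (★ `IrrClass.IsSpherical (cmLocalIntegralLevel L 3 H v)`)
  [FlathCorvallis1979 Thm. 3; Rogawski1990 §14.6 p. 242 «`π_v` is unramified for `v ∉ S′`»].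
* **conclusion (AE-ⅰ)** = the type of the binder `hAE` of ★ `definiteXiMembership_of_ch14` TOKEN FOR TOKEN: (B4)'s binders through `MemXiFamily P hH hHd μω hμu ξ`, then
  «∃ S : Finset, off S: at non-split `v` every `v`-constituent of `P` IS `πⁿ(ξ_v) ∘ e` (Keys label `πn` with `¬ L²`, any frame), at split `v` it IS in the ★ `cmSplitPacket`
  of `ξ` at `splitWitness v hs`».
PROOF (= the ★ #82 glue `F0P3LocalClassRouting.localRouting_of_memXiFamily` run for EVERY constituent instead of the chosen one).  `S` := the finite union of the exceptional
sets of (FLATH) at `P`, of ★ (SqNS♭) `squareIntegrableNotSpherical_nonsplit_cofinite` (a square-integrable class of `U(Φ₃)(L⁺_v)` is not `U(Φ₃)(𝒪_v)`-spherical), of ★ K3♭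
(a `U(H)(𝒪_v)`-spherical class is not supercuspidal: compact centre at non-split `v`, ★ `local_nonsplit_compactOpen_center_of_center_le`) and of ★
`eventually_exists_cmDatumLocalCongr_levelMatching_three` (a LEVEL-MATCHING frame `e₁`).  Off `S`, at a non-split `v`, D6 says the family's packet is `⟨x ∘ e₀, s⟩` with
`x ∈ JH(i_G(χ_ξ)) = {πn, π2}` (★ `KeysCaseTwoLabels`) and `s` supercuspidal, and every constituent `c` is a member: `c = s` is spherical-and-supercuspidal — absurd (K3♭ at `e₁`);
`c = x ∘ e₀ = x ∘ e` for ANY frame `e` (★ `comap_cmDatumLocalCongr_symm_eq`, `N = 3` odd); `x = π2` is absurd because `π2` IS square-integrable — Keys' case (2) has exactly one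
`L²` constituent (★ `keysCaseTwo_holds`, at `μω_v` quadratic by ★ `isQuadraticCharExtension_semilocalComponent_of_baseChange_eq`) and `πn` is not (`hn`) — so `π2 ∘ e₁` would be a
`U(Φ₃)(𝒪_v)`-spherical `L²` class (transport ★ `IrrClass.isSpherical_comap_iff_of_forall_mem_iff` along the level-matching `e₁`), contradicting (SqNS♭); hence `x = πn` and
`c = πn ∘ e`.  At a split `v` the family's packet IS the ★ `cmSplitPacket` (`IsXiLocalFamily`, first clause) and `c` is a member — at EVERY split `v`.
[cite: Rogawski1990, §14.6 p. 242; §12.2 (2) pp. 173–174; §13.1 Prop. 13.1.3 (d) p. 199; §14.2 pp. 232–233; §4.13 Lemma 4.13.1 (b) p. 62] [cite: FlathCorvallis1979, Thm. 3]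
[cite: HarishChandra1970, Part I §3, p. 9] [cite: Macdonald1971, Ch. V]
-/

set_option autoImplicit false
-- the mandated namespace repeats `HodgeConjecture.HodgeConjecture`, as in every `Theorems/*.lean` of this sub-problem
set_option linter.dupNamespace false

noncomputable section

open NumberField IsDedekindDomain MeasureTheory Filter
open scoped Matrix ComplexOrder

open Literature.NumberTheory Literature.NumberTheory.Automorphic Literature.NumberTheory.Automorphic.UnitaryGroup
open Literature.NumberTheory.Automorphic.IdeleClassGroup
open Literature.NumberTheory.GaloisRepresentations
open Literature.NumberTheory.Rogawski1990
open Summit.HodgeConjecture.HodgeConjecture.Cruxes.H413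

namespace Summit.HodgeConjecture.HodgeConjecture.R90.S9

open scoped Classical in
set_option synthInstance.maxHeartbeats 400000 in
set_option maxHeartbeats 8000000 in
/-- **(FLATH) ⟹ (AE-ⅰ) «ENVELOPE ⟹ E.V.P.»** — the first binder `hAE` of ★ `definiteXiMembership_of_ch14` (its type TOKEN FOR TOKEN as the conclusion) from the
ξ-free input `hFlath` «off a finite set of places every `v`-constituent of a discrete `P` of `U(H)` is `U(H)(𝒪_v)`-spherical» (JUNCTION PENDING: ★ E1
`OccursEventuallySpherical` + local isotypy); (SqNS♭), K3♭, Keys' case (2), congruence independence and level matching are ★.  No sorry; axioms TRIO.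
[cite: Rogawski1990, §14.6 p. 242; §12.2 (2) pp. 173–174; §13.1 Prop. 13.1.3 (d) p. 199; §14.2 pp. 232–233] [cite: FlathCorvallis1979, Thm. 3] -/
theorem aeXiTrigger_of_flath
    (hFlath : ∀ (L : Type) [Field L] [NumberField L] [IsCMField L] (H : Matrix (Fin 3) (Fin 3) L),
      (H.map (cmConjRingHom L))ᵀ = H → IsUnit H.det →
      ∀ (μA : Measure (adelicGroupData (↥(maximalRealSubfield L)) L (IsCMField.complexConj L) 3 H).automorphicQuotient)
        [(adelicGroupData (↥(maximalRealSubfield L)) L (IsCMField.complexConj L) 3 H).IsAutomorphicMeasure μA]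
        (P : DiscreteAutomorphicRep (adelicGroupData (↥(maximalRealSubfield L)) L (IsCMField.complexConj L) 3 H) μA),
        ∀ᶠ v : HeightOneSpectrum (𝓞 ↥(maximalRealSubfield L)) in cofinite,
          ∀ c : IrrClass ((cmDatum L 3 H).Local v),
            (IrrClass.comap (localPiEquiv L (IsCMField.complexConj L) 3 H v) c).IsConstituentOf
                (P.finRep.smoothPart.toRepresentation.comp (inclPlace (↥(maximalRealSubfield L)) L (IsCMField.complexConj L) 3 H v)) →
            c.IsSpherical (cmLocalIntegralLevel L 3 H v)) :
    ∀ (L : Type) [Field L] [NumberField L] [IsCMField L] (H : Matrix (Fin 3) (Fin 3) L)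
      (hH : (H.map (cmConjRingHom L))ᵀ = H) (hHd : IsUnit H.det),
      (∀ x : Fin 3 → L, Literature.AlgebraicGeometry.ShimuraVarieties.hermForm (cmConjRingHom L) H x x = 0 → x = 0) →
        (∃ τ : L →+* ℂ, (H.map τ).PosDef ∨ (-(H.map τ)).PosDef) →
    ∀ [∀ v : HeightOneSpectrum (𝓞 ↥(maximalRealSubfield L)), MeasurableSpace ((cmDatum L 3 H).Local v)]
      [∀ v : HeightOneSpectrum (𝓞 ↥(maximalRealSubfield L)),
        MeasurableSpace ((cmDatum L 2 (Matrix.of fun i j : Fin 2 => if i.val + j.val + 1 = 2 then (1 : L) else 0)).Local v ×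
          (cmDatum L 1 (Matrix.of fun i j : Fin 1 => if i.val + j.val + 1 = 1 then (1 : L) else 0)).Local v)]
      [∀ (v : HeightOneSpectrum (𝓞 ↥(maximalRealSubfield L)))
          (a : ((cmDatum L 2 (Matrix.of fun i j : Fin 2 => if i.val + j.val + 1 = 2 then (1 : L) else 0)).Local v ×
            (cmDatum L 1 (Matrix.of fun i j : Fin 1 => if i.val + j.val + 1 = 1 then (1 : L) else 0)).Local v)),
        MeasurableSpace (((cmDatum L 2 (Matrix.of fun i j : Fin 2 => if i.val + j.val + 1 = 2 then (1 : L) else 0)).Local v ×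
            (cmDatum L 1 (Matrix.of fun i j : Fin 1 => if i.val + j.val + 1 = 1 then (1 : L) else 0)).Local v) ⧸
          Subgroup.centralizer ({a} : Set ((cmDatum L 2 (Matrix.of fun i j : Fin 2 => if i.val + j.val + 1 = 2 then (1 : L) else 0)).Local v ×
            (cmDatum L 1 (Matrix.of fun i j : Fin 1 => if i.val + j.val + 1 = 1 then (1 : L) else 0)).Local v)))]
      [∀ (v : HeightOneSpectrum (𝓞 ↥(maximalRealSubfield L))) (γ : (cmDatum L 3 H).Local v),
        MeasurableSpace ((cmDatum L 3 H).Local v ⧸ Subgroup.centralizer ({γ} : Set ((cmDatum L 3 H).Local v)))]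
      (Δ : ∀ v : HeightOneSpectrum (𝓞 ↥(maximalRealSubfield L)), LocalTransferFactor L H v)
      (mH : ∀ v : HeightOneSpectrum (𝓞 ↥(maximalRealSubfield L)),
        OrbitalMeasureFamily ((cmDatum L 2 (Matrix.of fun i j : Fin 2 => if i.val + j.val + 1 = 2 then (1 : L) else 0)).Local v ×
          (cmDatum L 1 (Matrix.of fun i j : Fin 1 => if i.val + j.val + 1 = 1 then (1 : L) else 0)).Local v))
      (mG : ∀ v : HeightOneSpectrum (𝓞 ↥(maximalRealSubfield L)), OrbitalMeasureFamily ((cmDatum L 3 H).Local v))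
      (νG : ∀ v : HeightOneSpectrum (𝓞 ↥(maximalRealSubfield L)), Measure ((cmDatum L 3 H).Local v))
      (νH : ∀ v : HeightOneSpectrum (𝓞 ↥(maximalRealSubfield L)),
        Measure ((cmDatum L 2 (Matrix.of fun i j : Fin 2 => if i.val + j.val + 1 = 2 then (1 : L) else 0)).Local v ×
          (cmDatum L 1 (Matrix.of fun i j : Fin 1 => if i.val + j.val + 1 = 1 then (1 : L) else 0)).Local v))
      [∀ v : HeightOneSpectrum (𝓞 ↥(maximalRealSubfield L)), BorelSpace ((cmDatum L 3 H).Local v)]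
      [∀ v : HeightOneSpectrum (𝓞 ↥(maximalRealSubfield L)),
        BorelSpace ((cmDatum L 2 (Matrix.of fun i j : Fin 2 => if i.val + j.val + 1 = 2 then (1 : L) else 0)).Local v ×
          (cmDatum L 1 (Matrix.of fun i j : Fin 1 => if i.val + j.val + 1 = 1 then (1 : L) else 0)).Local v)]
      [∀ (v : HeightOneSpectrum (𝓞 ↥(maximalRealSubfield L)))
          (a : ((cmDatum L 2 (Matrix.of fun i j : Fin 2 => if i.val + j.val + 1 = 2 then (1 : L) else 0)).Local v ×
            (cmDatum L 1 (Matrix.of fun i j : Fin 1 => if i.val + j.val + 1 = 1 then (1 : L) else 0)).Local v)),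
        BorelSpace (((cmDatum L 2 (Matrix.of fun i j : Fin 2 => if i.val + j.val + 1 = 2 then (1 : L) else 0)).Local v ×
            (cmDatum L 1 (Matrix.of fun i j : Fin 1 => if i.val + j.val + 1 = 1 then (1 : L) else 0)).Local v) ⧸
          Subgroup.centralizer ({a} : Set ((cmDatum L 2 (Matrix.of fun i j : Fin 2 => if i.val + j.val + 1 = 2 then (1 : L) else 0)).Local v ×
            (cmDatum L 1 (Matrix.of fun i j : Fin 1 => if i.val + j.val + 1 = 1 then (1 : L) else 0)).Local v)))]
      [∀ (v : HeightOneSpectrum (𝓞 ↥(maximalRealSubfield L))) (γ : (cmDatum L 3 H).Local v),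
        BorelSpace ((cmDatum L 3 H).Local v ⧸ Subgroup.centralizer ({γ} : Set ((cmDatum L 3 H).Local v)))]
      [∀ v, (νG v).IsHaarMeasure] [∀ v, (νG v).IsMulRightInvariant] [∀ v, (νH v).IsHaarMeasure] [∀ v, (νH v).IsMulRightInvariant],
      ∀ (μω : HeckeCharacter L) (hμu : μω.IsUnitary),
      (∀ x : Literature.NumberTheory.GaloisRepresentations.ideleGroup ↥(maximalRealSubfield L),
        μω (AdeleRing.ideleBaseChange (↥(maximalRealSubfield L)) L x) = quadraticHeckeCharCM L x) →
      Δ = finExplicitCollection L H μω (finExplicitDelta_conj_left_all L H μω) (finExplicitDelta_conj_right_all L H μω) →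
      (∀ v : HeightOneSpectrum (𝓞 ↥(maximalRealSubfield L)), (mH v).IsCanonical (IsLocalGRegular L v) (νH v) ∧
        (mG v).IsCanonical (fun γ => IsRegularElt (γ.val : GL (Fin 3) (UnitaryGroup.LocalRing L v))) (νG v)) →
      ∀ (hQS : CMCharIdentityPackageTestSigned L H hH hHd νH νG μω hμu Δ mH mG),
      (∀ v : HeightOneSpectrum (𝓞 ↥(maximalRealSubfield L)), (∀ w : PlacesOver L v, IsCMField.complexConj L • w.1 = w.1) →
        IsLocalDeltaTransferExists L H v (Δ v) (mH v) (mG v) Literature.NumberTheory.Rogawski1990.IsLocSmooth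
          Literature.NumberTheory.Rogawski1990.IsLocSmooth) →
      ∀ (ξ : OneDimAutRepH L)
        (μA : Measure (adelicGroupData (↥(maximalRealSubfield L)) L (IsCMField.complexConj L) 3 H).automorphicQuotient)
        [(adelicGroupData (↥(maximalRealSubfield L)) L (IsCMField.complexConj L) 3 H).IsAutomorphicMeasure μA]
        (P : DiscreteAutomorphicRep (adelicGroupData (↥(maximalRealSubfield L)) L (IsCMField.complexConj L) 3 H) μA),
        MemXiFamily P hH hHd μω hμu ξ →
        -- (AE) «t(P) = t(Π(ξ))»: off a finite set of finite places, P_v IS πⁿ(ξ_v) ∘ e (non-split v) ∕ the split member i_G(ξ_v ⊗ μ_w ∘ det₀) (split v)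
        (∃ S : Finset (HeightOneSpectrum (𝓞 ↥(maximalRealSubfield L))),
          (∀ v : HeightOneSpectrum (𝓞 ↥(maximalRealSubfield L)), v ∉ S →
            ∀ (hns : ∀ w : PlacesOver L v, IsCMField.complexConj L • w.1 = w.1)
              (T : GL (Fin 3) (LocalRing L v)) (a : LocalRing L v) (ha : IsUnit a)
              (h : formCongr (conjLocal L (IsCMField.complexConj L) v) T (H.map (algebraMap L (LocalRing L v))) =
                a • (Matrix.of fun i j : Fin 3 => if i.val + j.val + 1 = 3 then (1 : L) else 0).map (algebraMap L (LocalRing L v))),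
            ∀ [MeasurableSpace (Gqs L v ⧸ Subgroup.center (Gqs L v))] [BorelSpace (Gqs L v ⧸ Subgroup.center (Gqs L v))]
              (μZ : Measure (Gqs L v ⧸ Subgroup.center (Gqs L v))) [μZ.IsHaarMeasure],
            ∀ (π2 πn : IrrClass (Gqs L v)),
              KeysCaseTwoLabels L v (μω.semilocalComponent L v) (torusLocalComponent L (IsCMField.complexConj L) v ξ.η)
                (torusLocalComponent L (IsCMField.complexConj L) v ξ.ψ) π2 πn →
              ¬ πn.IsSquareIntegrable μZ →
              ∀ c : IrrClass ((cmDatum L 3 H).Local v),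
                (IrrClass.comap (localPiEquiv L (IsCMField.complexConj L) 3 H v) c).IsConstituentOf
                    (P.finRep.smoothPart.toRepresentation.comp (inclPlace (↥(maximalRealSubfield L)) L (IsCMField.complexConj L) 3 H v)) →
                c = IrrClass.comap (cmDatumLocalCongr L v T ha h).symm πn) ∧
          (∀ v : HeightOneSpectrum (𝓞 ↥(maximalRealSubfield L)), v ∉ S →
            ∀ (hs : ∃ w : PlacesOver L v, IsCMField.complexConj L • w.1 ≠ w.1),
              ∀ c : IrrClass ((cmDatum L 3 H).Local v),
                (IrrClass.comap (localPiEquiv L (IsCMField.complexConj L) 3 H v) c).IsConstituentOf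
                    (P.finRep.smoothPart.toRepresentation.comp (inclPlace (↥(maximalRealSubfield L)) L (IsCMField.complexConj L) 3 H v)) →
                c ∈ (cmSplitPacket L H hH hHd v (splitWitness v hs) (splitWitness_spec v hs) (ξ.splitν₀ μω (splitWitness v hs).1)
                  (ξ.locψ (splitWitness v hs).1) (ξ.norm_splitν₀_apply hμu (splitWitness v hs).1)
                  (ξ.continuous_splitν₀ μω (splitWitness v hs).1) (ξ.norm_locψ_apply (splitWitness v hs).1)
                  (ξ.continuous_locψ (splitWitness v hs).1)).members)) := by
  intro L _ _ _ H hH hHd _hanis _hS₀ _ _ _ _ Δ mH mG νG νH _ _ _ _ _ _ _ _ μω hμu hμω _hΔ _hcan hQS _hex ξ μA _ P hmem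
  obtain ⟨Pv, hfam, hloc⟩ := hmem
  -- the four cofinite supplies: (FLATH) at `P`, ★ (SqNS♭), ★ K3♭, ★ level-matching frames
  have hSq := F0P3SqIntNotSphericalNonsplitCofinite.squareIntegrableNotSpherical_nonsplit_cofinite L
  have hK3 := F0P3SqNSNonsplitConsumers.eventually_not_isSupercuspidal_of_isSpherical_congr_of_nonsplit L H hSq
  have hlev := eventually_exists_cmDatumLocalCongr_levelMatching_three L H hH hHd
  have hfin := Filter.eventually_cofinite.1 ((hFlath L H hH hHd μA P).and (hSq.and (hK3.and hlev)))
  refine ⟨hfin.toFinset, fun v hv hns T a ha h _ _ μZ _ π2 πn hK hn c hc => ?_, fun v _ hs c hc => ?_⟩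
  · -- NON-SPLIT `v ∉ S`
    have hv' : (∀ c : IrrClass ((cmDatum L 3 H).Local v),
        (IrrClass.comap (localPiEquiv L (IsCMField.complexConj L) 3 H v) c).IsConstituentOf
            (P.finRep.smoothPart.toRepresentation.comp (inclPlace (↥(maximalRealSubfield L)) L (IsCMField.complexConj L) 3 H v)) →
          c.IsSpherical (cmLocalIntegralLevel L 3 H v)) ∧
        ((∀ w : PlacesOver L v, IsCMField.complexConj L • w.1 = w.1) →
          ∀ [MeasurableSpace (Gqs L v ⧸ Subgroup.center (Gqs L v))] [BorelSpace (Gqs L v ⧸ Subgroup.center (Gqs L v))]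
            (μZ : Measure (Gqs L v ⧸ Subgroup.center (Gqs L v))) [μZ.IsHaarMeasure] (c : IrrClass (Gqs L v)),
            c.IsSquareIntegrable μZ → ¬ c.IsSpherical (cmLocalIntegralLevel L 3 (qsForm L) v)) ∧
        ((∀ w : PlacesOver L v, IsCMField.complexConj L • w.1 = w.1) →
          IsCompact ((Subgroup.center (Gqs L v) : Subgroup (Gqs L v)) : Set (Gqs L v)) →
          ∀ [MeasurableSpace (Gqs L v ⧸ Subgroup.center (Gqs L v))] [BorelSpace (Gqs L v ⧸ Subgroup.center (Gqs L v))]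
            (μZ : Measure (Gqs L v ⧸ Subgroup.center (Gqs L v))) [μZ.IsHaarMeasure]
            (e : (cmDatum L 3 H).Local v ≃ₜ* Gqs L v),
            (∀ g : (cmDatum L 3 H).Local v, e g ∈ cmLocalIntegralLevel L 3 (qsForm L) v ↔ g ∈ cmLocalIntegralLevel L 3 H v) →
            ∀ c : IrrClass ((cmDatum L 3 H).Local v), c.IsSpherical (cmLocalIntegralLevel L 3 H v) → ¬ c.IsSupercuspidal) ∧
        ((∀ w : PlacesOver L v, IsCMField.complexConj L • w.1 = w.1) →
          ∃ (T : GL (Fin 3) (LocalRing L v)) (a : LocalRing L v) (ha : IsUnit a)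
            (h : formCongr (conjLocal L (IsCMField.complexConj L) v) T (H.map (algebraMap L (LocalRing L v))) =
              a • (Rogawski1990.qsForm L).map (algebraMap L (LocalRing L v))),
            ∀ g : (cmDatum L 3 H).Local v,
              (cmDatumLocalCongr L v T ha h).symm g ∈ cmLocalIntegralLevel L 3 (Rogawski1990.qsForm L) v ↔
                g ∈ cmLocalIntegralLevel L 3 H v) := by
      by_contra hc'
      exact hv (hfin.mem_toFinset.2 hc')
    obtain ⟨hsphv, hSqv, hK3v, hlevv⟩ := hv'
    have hcsph : c.IsSpherical (cmLocalIntegralLevel L 3 H v) := hsphv c hc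
    obtain ⟨T₁, a₁, ha₁, h₁, hlev₁⟩ := hlevv hns
    -- D6 at the non-split `v`: the family's packet is `⟨x ∘ e₀, s⟩`
    obtain ⟨T₀, a₀, ha₀, h₀, x, s, hPv, hx, hs⟩ := hfam.2 v hns
    have hcm : c ∈ (Pv v).members := hloc v c hc
    rw [hPv, LocalAPacket.mem_members_iff] at hcm
    rcases hcm with hcx | hcs
    · -- `c = x ∘ e₀`, `x ∈ {πn, π2}`
      have hcx' : c = IrrClass.comap (cmDatumLocalCongr L v T₀ ha₀ h₀).symm x := hcx
      rcases (hK.2 x).1 hx with hxn | hx2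
      · rw [hcx', hxn]
        exact F0P3cDbTEnvelopeTrichotomy.comap_cmDatumLocalCongr_symm_eq L H hH T₀ T ha₀ ha h₀ h πn
      · exfalso
        -- `π2` IS square-integrable: Keys' case (2) has exactly one `L²` constituent and `πn` is not it
        obtain ⟨πs₀, πn₀, _hne₀, hJH₀, hs₀, hn₀⟩ :=
          (F0P3N3ConeClosed.keysCaseTwo_holds L).exists_labels v hns (μω.semilocalComponent L v)
            (torusLocalComponent L (IsCMField.complexConj L) v ξ.η) (torusLocalComponent L (IsCMField.complexConj L) v ξ.ψ)
            (isQuadraticCharExtension_semilocalComponent_of_baseChange_eq μω hμω v)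
            (Units.continuous_val.comp (continuous_semilocalComponent (v := v) L μω))
            (continuous_torusLocalComponent (v := v) L (IsCMField.complexConj L) ξ.η)
            (continuous_torusLocalComponent (v := v) L (IsCMField.complexConj L) ξ.ψ) μZ
        have hπn : πn = πn₀ ∨ πn = πs₀ := (hJH₀ πn).1 ((hK.2 πn).2 (Or.inl rfl))
        have hπ2 : π2 = πn₀ ∨ π2 = πs₀ := (hJH₀ π2).1 ((hK.2 π2).2 (Or.inr rfl))
        have hπ2L2 : π2.IsSquareIntegrable μZ := by
          rcases hπ2 with h2 | h2
          · rcases hπn with hn' | hn'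
            · exact absurd (h2.trans hn'.symm) hK.1
            · exact absurd (hn' ▸ hs₀) hn
          · exact h2 ▸ hs₀
        -- `c = π2 ∘ e₀ = π2 ∘ e₁` is `U(H)(𝒪_v)`-spherical; transport along the level-matching `e₁` and contradict (SqNS♭)
        have hsph₁ : (IrrClass.comap (cmDatumLocalCongr L v T₁ ha₁ h₁).symm π2).IsSpherical (cmLocalIntegralLevel L 3 H v) := by
          rw [← F0P3cDbTEnvelopeTrichotomy.comap_cmDatumLocalCongr_symm_eq L H hH T₀ T₁ ha₀ ha₁ h₀ h₁ π2, ← hx2, ← hcx']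
          exact hcsph
        exact hSqv hns μZ π2 hπ2L2
          ((IrrClass.isSpherical_comap_iff_of_forall_mem_iff (cmDatumLocalCongr L v T₁ ha₁ h₁).symm π2 hlev₁).1 hsph₁)
    · -- `c = s` supercuspidal AND spherical: absurd by K3♭ (compact centre at the non-split `v`, level-matching `e₁`)
      have hZ : IsCompact ((Subgroup.center (Gqs L v) : Subgroup (Gqs L v)) : Set (Gqs L v)) :=
        (F0P3bLocalNonsplitCompactCenter.local_nonsplit_compactOpen_center_of_center_le L 3 (qsForm L) (isUnit_antidiagOne_det L 3) v hns
          (forall_mem_center_cmLocal_eq_scalar L (qsForm L) (antidiagOne_isHermitian L 3) (isUnit_antidiagOne_det L 3) v hns)).2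
      exact (hK3v hns hZ μZ (cmDatumLocalCongr L v T₁ ha₁ h₁).symm hlev₁ c hcsph (hs c hcs)).elim
  · -- SPLIT `v`: the family's packet IS the D6 split packet at the fixed witness (every split `v`, not only `v ∉ S`)
    have hcm : c ∈ (Pv v).members := hloc v c hc
    rw [hfam.1 v hs] at hcm
    exact hcm

end Summit.HodgeConjecture.HodgeConjecture.R90.S9

end
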